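import Summits.AtomisticToContinuum.FouriersLaw.Theses.EmbeddedDrudeMourre
import Summits.AtomisticToContinuum.FouriersLaw.Theses.StaticAbelianSqueeze
import Summits.AtomisticToContinuum.FouriersLaw.Theorems.AbelThermodynamicLimit.Negative.LoadBearing
import Summits.AtomisticToContinuum.FouriersLaw.Theorems.EmbeddedDrudeMourreAbelThermodynamicLimitOfLowerBound
import HarnessLib

/-!
# The crux `EmbeddedDrudeMourre.AbelThermodynamicLimit`: its WITNESS-FREE form is all the route consumes
(line `loomis-compact-horizon-witness`, lead c8; item stmt-AtomisticToContinuum-12596; `--supports` file, closes nothing)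

Write `P = pinnedChain ω₂ lam β γ` (all `> 0`), `Uniq` = weak-NESS uniqueness, `H_T` = "an Abelian Green–Kubo witness
`(μT, D, κ)` exists at `T`" (DLR state, `μT`-preserving dynamics, absolutely convergent correlations, `0 < κ`,
`T⁻² ∫₀^∞ e^{-νt} C_T → κ`), `D_N` the response coefficients of a steady family at `T`.

The crux says: `Uniq → ∀ T > 0, H_T → ∃ (μT, D, κ), Witness(μT, D, κ) ∧ ∀ steady family, ∀ Dn, Dn → κ`.
Its WITNESS-FREE form `RC` says: `Uniq → ∀ T > 0, H_T → ∃ κ > 0, ∀ steady family, ∀ Dn, Dn → κ`.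

## Results (sorry-free; no definitions — `RC` and "response convergence" are written out in the types; the three
## theorems are registered stubs of the crux item, hence the `stub_` names)

* `stub_witnessFreeLimitOfCrux` — the crux implies `RC` (drop the output witness).
* `stub_closesOfWitnessFreeLimit` — `RC` is a DROP-IN replacement of the crux in the route's deciding theorem:
  `DrudeDissolution → AbelOfSpectralDensity → GreenKuboContinuation → RC → NessUnique → FiniteResponseOfUnique → FouriersLaw`
  (the proof of `EmbeddedDrudeMourre.closes` uses the crux's output only through `⟨κ, 0 < κ, Dn → κ⟩`).
* `stub_witnessFreeLimitOfConvergenceOfLowerBound` — `RC` follows from CONVERGENCE of the response sequences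
  (`∀ steady family, ∀ Dn, ∃ L, Dn → L`) and the existing positivity item `StaticAbelianSqueeze.ConductanceLowerBound`
  (stmt-AtomisticToContinuum-11749); the witness hypothesis `H_T` is not used.

So the route needs from this node exactly "`lim_N D_N` exists and is positive" — clause (ii) of `FouriersLawFor P` at `T` —
whereas the crux as typed additionally asserts the Green–Kubo identification "`lim_N D_N` is the Abel limit of SOME witness"
((Rb) ∧ (Rc) of `stub_regularityIffCommonLimit`), which `closes` discards.  Plan-level record for D-0014; compare
`stub_cruxOfRegularityOfLowerBound` ((R) → CLB → crux) and `stub_repairedCruxOfRegularity` ((R) → repaired crux).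
References: Bonetto–Lebowitz–Rey-Bellet 2000 §5.3 eq. (33), §7 eq. (37); Kundu–Dhar–Narayan 2009.
-/

noncomputable section

open MeasureTheory Filter Set
open scoped Topology

namespace Summit.AtomisticToContinuum.FouriersLaw.Theorems.AbelThermodynamicLimit.LoomisCompactHorizonWitness

open Literature.MathematicalPhysics.KineticTheory.HeatConduction

/-! ## §1 The witness-free form `RC` is weaker than the crux -/

/-- **The crux implies its witness-free form `RC`** (forget the output witness, keep `κ`). [folklore] -/
theorem stub_witnessFreeLimitOfCrux :
    Summit.AtomisticToContinuum.FouriersLaw.Theses.EmbeddedDrudeMourre.AbelThermodynamicLimit → (∀ ω₂ lam β γ : ℝ, 0 < ω₂ → 0 < lam → 0 < β → 0 < γ → (∀ (N : ℕ) (T_L T_R : ℝ), 0 < T_L → 0 < T_R → ∀ μ ν : MeasureTheory.Measure (Literature.MathematicalPhysics.KineticTheory.HeatConduction.PhaseSpace N), (Literature.MathematicalPhysics.KineticTheory.HeatConduction.pinnedChain ω₂ lam β γ).IsSteadyState N T_L T_R μ → (Literature.MathematicalPhysics.KineticTheory.HeatConduction.pinnedChain ω₂ lam β γ).IsSteadyState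 N T_L T_R ν → μ = ν) → ∀ T : ℝ, 0 < T → (∃ (μT : MeasureTheory.Measure Literature.MathematicalPhysics.KineticTheory.HeatConduction.ChainConfig) (D : Literature.MathematicalPhysics.KineticTheory.HeatConduction.InfiniteChainDynamics (Literature.MathematicalPhysics.KineticTheory.HeatConduction.pinnedChain ω₂ lam β γ)) (κ : ℝ), (Literature.MathematicalPhysics.KineticTheory.HeatConduction.pinnedChain ω₂ lam β γ).IsChainGibbsMeasure T μT ∧ D.PreservesMeasure μT ∧ (∀ t : ℝ, D.HasAbsConvergentCorrelation μT t) ∧ 0 < κ ∧ Filter.Tendsto (fun ν : ℝ => (T ^ 2)⁻¹ * MeasureTheory.integral (MeasureTheory.volume.restrict (Set.Ioi (0:ℝ))) (fun t : ℝ => Real.exp (-(ν * t)) * D.currentCorrelation μT t)) (nhdsWithin (0:ℝ) (Set.Ioi 0)) (nhds κ)) → ∃ κ : ℝ, 0 < κ ∧ ∀ μ : (N : ℕ) → ℝ → ℝ → MeasureTheory.Measure (Literature.MathematicalPhysics.KineticTheory.HeatConduction.PhaseSpace N), (∀ (N : ℕ) (T_L T_R : ℝ), 0 < T_L → 0 <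 T_R → (Literature.MathematicalPhysics.KineticTheory.HeatConduction.pinnedChain ω₂ lam β γ).IsSteadyState N T_L T_R (μ N T_L T_R)) → ∀ Dn : ℕ → ℝ, (∀ N : ℕ, Filter.Tendsto (fun δ : ℝ => (Literature.MathematicalPhysics.KineticTheory.HeatConduction.pinnedChain ω₂ lam β γ).totalCurrent (μ N (T + δ / 2) (T - δ / 2)) / δ) (nhdsWithin 0 {(0 : ℝ)}ᶜ) (nhds (Dn N))) → Filter.Tendsto Dn Filter.atTop (nhds κ)) := by
  intro h ω₂ lam β γ hω hl hβ hγ hU T hT hwit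
  obtain ⟨-, -, κ, ⟨-, -, -, hκ, -⟩, hfam⟩ := h ω₂ lam β γ hω hl hβ hγ hU T hT hwit
  exact ⟨κ, hκ, hfam⟩

/-! ## §2 `RC` is a drop-in replacement of the crux in the route's deciding theorem -/

/-- **The route closes from the witness-free form.**  Verbatim the proof of `EmbeddedDrudeMourre.closes` with the crux
replaced by `RC`: clause (i) from the PROVED `pinnedChain_exists_isSteadyState` and `NessUnique`; clause (ii): the dissolved
Drude atom and the Poisson-kernel lemma give the Abelian witness on the corner `(0, T₀)`, `GreenKuboContinuation` extends it
to every `T > 0`, `RC` turns it into `∃ κ > 0, Dn → κ` for every steady family, and `FiniteResponseOfUnique` supplies the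
response sequences. [cite: BonettoLebowitzReyBellet2000, §5.3 eq. (33)] -/
theorem stub_closesOfWitnessFreeLimit :
    Summit.AtomisticToContinuum.FouriersLaw.Theses.EmbeddedDrudeMourre.DrudeDissolution → Summit.AtomisticToContinuum.FouriersLaw.Theses.EmbeddedDrudeMourre.AbelOfSpectralDensity → Summit.AtomisticToContinuum.FouriersLaw.Theses.EmbeddedDrudeMourre.GreenKuboContinuation → (∀ ω₂ lam β γ : ℝ, 0 < ω₂ → 0 < lam → 0 < β → 0 < γ → (∀ (N : ℕ) (T_L T_R : ℝ), 0 < T_L → 0 < T_R → ∀ μ ν : MeasureTheory.Measure (Literature.MathematicalPhysics.KineticTheory.HeatConduction.PhaseSpace N), (Literature.MathematicalPhysics.KineticTheory.HeatConduction.pinnedChain ω₂ lam β γ).IsSteadyState N T_L T_R μ → (Literature.MathematicalPhysics.KineticTheory.HeatConduction.pinnedChain ω₂ lam β γ).IsSteadyState N T_L T_R ν → μ = ν) → ∀ T : ℝ, 0 < T → (∃ (μT : MeasureTheory.Measure Literature.MathematicalPhysics.KineticTheory.HeatConduction.ChainConfig) (D : Literature.MathematicalPhysics.KineticTheory.HeatConduction.InfiniteChainDynamics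 (Literature.MathematicalPhysics.KineticTheory.HeatConduction.pinnedChain ω₂ lam β γ)) (κ : ℝ), (Literature.MathematicalPhysics.KineticTheory.HeatConduction.pinnedChain ω₂ lam β γ).IsChainGibbsMeasure T μT ∧ D.PreservesMeasure μT ∧ (∀ t : ℝ, D.HasAbsConvergentCorrelation μT t) ∧ 0 < κ ∧ Filter.Tendsto (fun ν : ℝ => (T ^ 2)⁻¹ * MeasureTheory.integral (MeasureTheory.volume.restrict (Set.Ioi (0:ℝ))) (fun t : ℝ => Real.exp (-(ν * t)) * D.currentCorrelation μT t)) (nhdsWithin (0:ℝ) (Set.Ioi 0)) (nhds κ)) → ∃ κ : ℝ, 0 < κ ∧ ∀ μ : (N : ℕ) → ℝ → ℝ → MeasureTheory.Measure (Literature.MathematicalPhysics.KineticTheory.HeatConduction.PhaseSpace N), (∀ (N : ℕ) (T_L T_R : ℝ), 0 < T_L → 0 < T_R → (Literature.MathematicalPhysics.KineticTheory.HeatConduction.pinnedChain ω₂ lam β γ).IsSteadyState N T_L T_R (μ N T_L T_R)) → ∀ Dn : ℕ → ℝ, (∀ N : ℕ, Filter.Tendsto (fun δ : ℝ => (Literature.MathematicalPhysics.KineticTheory.HeatConduction.pinnedChain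 ω₂ lam β γ).totalCurrent (μ N (T + δ / 2) (T - δ / 2)) / δ) (nhdsWithin 0 {(0 : ℝ)}ᶜ) (nhds (Dn N))) → Filter.Tendsto Dn Filter.atTop (nhds κ)) → Summit.AtomisticToContinuum.FouriersLaw.Theses.EmbeddedDrudeMourre.NessUnique → Summit.AtomisticToContinuum.FouriersLaw.Theses.EmbeddedDrudeMourre.FiniteResponseOfUnique → Literature.MathematicalPhysics.KineticTheory.HeatConduction.FouriersLaw := by
  intro hDD hA hC hRC hU hF
  unfold Literature.MathematicalPhysics.KineticTheory.HeatConduction.FouriersLaw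
  intro ω₂ lam β γ hω hl hβ hγ
  have hUq := hU ω₂ lam β γ hω hl hβ hγ
  unfold OscillatorChain.FouriersLawFor
  refine ⟨fun N T_L T_R h1 h2 => ?_, ?_⟩
  · obtain ⟨μ, hμ⟩ := pinnedChain_exists_isSteadyState hω hl hβ hγ N h1 h2
    exact ⟨μ, hμ, fun ν hν => hUq N T_L T_R h1 h2 ν μ hν hμ⟩
  -- clause (ii). Step 1: the Abelian Green–Kubo witness on the corner `(0, T₀)`
  obtain ⟨T₀, hT₀, hdiss⟩ := hDD ω₂ lam β γ hω hl hβ hγ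
  have hcorner : ∀ T : ℝ, 0 < T → T < T₀ →
      ∃ (μT : Measure ChainConfig) (D : InfiniteChainDynamics (pinnedChain ω₂ lam β γ)) (κ : ℝ),
        (pinnedChain ω₂ lam β γ).IsChainGibbsMeasure T μT ∧ D.PreservesMeasure μT ∧
          (∀ t : ℝ, D.HasAbsConvergentCorrelation μT t) ∧ 0 < κ ∧
          Tendsto (fun ν : ℝ => (T ^ 2)⁻¹ *
              ∫ t in Ioi (0 : ℝ), Real.exp (-(ν * t)) * D.currentCorrelation μT t)
            (𝓝[>] (0 : ℝ)) (𝓝 κ) := by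
    intro T hT hTlt
    obtain ⟨μT, D, hG, hP, hAC, σ, hσ, hCσ, δ, g, hδ, hg, hg0, hgpos, hac⟩ := hdiss T hT hTlt
    refine ⟨μT, D, (T ^ 2)⁻¹ * (Real.pi * g 0), hG, hP, hAC,
      mul_pos (inv_pos.mpr (pow_pos hT 2)) (mul_pos Real.pi_pos hgpos), ?_⟩
    exact (hA σ (D.currentCorrelation μT) δ g hσ hδ hCσ hg hg0 hac).const_mul ((T ^ 2)⁻¹)
  -- Step 2: continuation to every temperature
  have hall := hC ω₂ lam β γ hω hl hβ hγ T₀ hT₀ hcorner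
  -- Step 3: the witness-free Abelian thermodynamic limit
  have hW : ∀ T : ℝ, 0 < T → ∃ κ : ℝ, 0 < κ ∧
      ∀ μ : (N : ℕ) → ℝ → ℝ → Measure (PhaseSpace N),
        (∀ (N : ℕ) (T_L T_R : ℝ), 0 < T_L → 0 < T_R →
          (pinnedChain ω₂ lam β γ).IsSteadyState N T_L T_R (μ N T_L T_R)) →
        ∀ Dn : ℕ → ℝ, (∀ N : ℕ, Tendsto (fun δ : ℝ =>
            (pinnedChain ω₂ lam β γ).totalCurrent (μ N (T + δ / 2) (T - δ / 2)) / δ)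
          (𝓝[≠] 0) (𝓝 (Dn N))) → Tendsto Dn atTop (𝓝 κ) :=
    fun T hT => hRC ω₂ lam β γ hω hl hβ hγ hUq T hT (hall T hT)
  classical
  refine ⟨fun T => if hT : 0 < T then Classical.choose (hW T hT) else 1, fun T hT => ?_, ?_⟩
  · simp only [dif_pos hT]
    exact (Classical.choose_spec (hW T hT)).1
  intro μ hμ T hT
  have hD : ∀ N : ℕ, ∃ D : ℝ, Tendsto (fun δ : ℝ =>
      (pinnedChain ω₂ lam β γ).totalCurrent (μ N (T + δ / 2) (T - δ / 2)) / δ) (𝓝[≠] 0) (𝓝 D) :=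
    hF ω₂ lam β γ hω hl hβ hγ hUq μ hμ T hT
  refine ⟨fun N => Classical.choose (hD N), fun N => Classical.choose_spec (hD N), ?_⟩
  simp only [dif_pos hT]
  exact (Classical.choose_spec (hW T hT)).2 μ hμ _ fun N => Classical.choose_spec (hD N)

/-! ## §3 `RC` from convergence of the responses and the positivity item; the witness hypothesis is idle -/

/-- **`RC` ⇐ convergence of `D_N` ∧ `ConductanceLowerBound`.**  If along every steady family every response sequence at
`T` converges (to some real limit), then the existing positivity item CLB (stmt-AtomisticToContinuum-11749) gives the
witness-free form of the crux: the canonical family's limit `L` is `≥ c > 0` (`ge_of_tendsto`), and every other family has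
the SAME response sequence (`Negative.response_unique`, weak-NESS uniqueness being proved).  The Abelian witness hypothesis
`H_T` is not used — exactly as in `stub_cruxOfRegularityOfLowerBound`. [cite: BonettoLebowitzReyBellet2000, §5.3 eq. (33)] -/
theorem stub_witnessFreeLimitOfConvergenceOfLowerBound :
    (∀ ω₂ lam β γ : ℝ, 0 < ω₂ → 0 < lam → 0 < β → 0 < γ → (∀ (N : ℕ) (T_L T_R : ℝ), 0 < T_L → 0 < T_R → ∀ μ ν : MeasureTheory.Measure (Literature.MathematicalPhysics.KineticTheory.HeatConduction.PhaseSpace N), (Literature.MathematicalPhysics.KineticTheory.HeatConduction.pinnedChain ω₂ lam β γ).IsSteadyState N T_L T_R μ → (Literature.MathematicalPhysics.KineticTheory.HeatConduction.pinnedChain ω₂ lam β γ).IsSteadyState N T_L T_R ν → μ = ν) → ∀ μ : (N : ℕ) → ℝ → ℝ → MeasureTheory.Measure (Literature.MathematicalPhysics.KineticTheory.HeatConduction.PhaseSpace N), (∀ (N : ℕ) (T_L T_R : ℝ), 0 < T_L → 0 < T_R → (Literature.MathematicalPhysics.KineticTheory.HeatConduction.pinnedChain ω₂ lam β γ).IsSteadyState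 N T_L T_R (μ N T_L T_R)) → ∀ T : ℝ, 0 < T → ∀ Dn : ℕ → ℝ, (∀ N : ℕ, Filter.Tendsto (fun δ : ℝ => (Literature.MathematicalPhysics.KineticTheory.HeatConduction.pinnedChain ω₂ lam β γ).totalCurrent (μ N (T + δ / 2) (T - δ / 2)) / δ) (nhdsWithin 0 {(0 : ℝ)}ᶜ) (nhds (Dn N))) → ∃ L : ℝ, Filter.Tendsto Dn Filter.atTop (nhds L)) → Summit.AtomisticToContinuum.FouriersLaw.Theses.StaticAbelianSqueeze.ConductanceLowerBound → (∀ ω₂ lam β γ : ℝ, 0 < ω₂ → 0 < lam → 0 < β → 0 < γ → (∀ (N : ℕ) (T_L T_R : ℝ), 0 < T_L → 0 < T_R → ∀ μ ν : MeasureTheory.Measure (Literature.MathematicalPhysics.KineticTheory.HeatConduction.PhaseSpace N), (Literature.MathematicalPhysics.KineticTheory.HeatConduction.pinnedChain ω₂ lam β γ).IsSteadyState N T_L T_R μ → (Literature.MathematicalPhysics.KineticTheory.HeatConduction.pinnedChain ω₂ lam β γ).IsSteadyState N T_L T_R ν → μ = ν) → ∀ T : ℝ, 0 < T → (∃ (μT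 : MeasureTheory.Measure Literature.MathematicalPhysics.KineticTheory.HeatConduction.ChainConfig) (D : Literature.MathematicalPhysics.KineticTheory.HeatConduction.InfiniteChainDynamics (Literature.MathematicalPhysics.KineticTheory.HeatConduction.pinnedChain ω₂ lam β γ)) (κ : ℝ), (Literature.MathematicalPhysics.KineticTheory.HeatConduction.pinnedChain ω₂ lam β γ).IsChainGibbsMeasure T μT ∧ D.PreservesMeasure μT ∧ (∀ t : ℝ, D.HasAbsConvergentCorrelation μT t) ∧ 0 < κ ∧ Filter.Tendsto (fun ν : ℝ => (T ^ 2)⁻¹ * MeasureTheory.integral (MeasureTheory.volume.restrict (Set.Ioi (0:ℝ))) (fun t : ℝ => Real.exp (-(ν * t)) * D.currentCorrelation μT t)) (nhdsWithin (0:ℝ) (Set.Ioi 0)) (nhds κ)) → ∃ κ : ℝ, 0 < κ ∧ ∀ μ : (N : ℕ) → ℝ → ℝ → MeasureTheory.Measure (Literature.MathematicalPhysics.KineticTheory.HeatConduction.PhaseSpace N), (∀ (N : ℕ) (T_L T_R : ℝ), 0 < T_L → 0 < T_R → (Literature.MathematicalPhysics.KineticTheory.HeatConduction.pinnedChain ω₂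 lam β γ).IsSteadyState N T_L T_R (μ N T_L T_R)) → ∀ Dn : ℕ → ℝ, (∀ N : ℕ, Filter.Tendsto (fun δ : ℝ => (Literature.MathematicalPhysics.KineticTheory.HeatConduction.pinnedChain ω₂ lam β γ).totalCurrent (μ N (T + δ / 2) (T - δ / 2)) / δ) (nhdsWithin 0 {(0 : ℝ)}ᶜ) (nhds (Dn N))) → Filter.Tendsto Dn Filter.atTop (nhds κ)) := by
  intro hconv hCLB ω₂ lam β γ hω hl hβ hγ hU T hT _hwit
  -- the canonical steady family and its responses at `T`
  obtain ⟨μc, Dc, hμc, hDc⟩ := exists_steadyFamily_response ω₂ lam β γ hω hl hβ hγ hU T hT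
  obtain ⟨L, hL⟩ := hconv ω₂ lam β γ hω hl hβ hγ hU μc hμc T hT Dc hDc
  obtain ⟨c, hc, N₁, hN₁⟩ := hCLB ω₂ lam β γ hω hl hβ hγ hU μc hμc T hT Dc hDc
  have hLpos : 0 < L := by
    have h1 : c ≤ L := by
      refine ge_of_tendsto hL ?_
      filter_upwards [eventually_ge_atTop N₁] with N hN
      exact hN₁ N hN
    exact lt_of_lt_of_le hc h1
  refine ⟨L, hLpos, fun μ hμ Dn hDn => ?_⟩
  have hDD : Dn = Dc :=
    Summit.AtomisticToContinuum.FouriersLaw.Theorems.AbelThermodynamicLimit.Negative.response_unique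
      hω hl hβ hγ hμ hμc hT hDn hDc
  rw [hDD]
  exact hL

end Summit.AtomisticToContinuum.FouriersLaw.Theorems.AbelThermodynamicLimit.LoomisCompactHorizonWitness

end
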